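import Mathlib.AlgebraicGeometry.IdealSheaf.Functorial
import Mathlib.AlgebraicGeometry.Morphisms.ClosedImmersion
import HarnessLib

/-!
# A closed subscheme which agrees with a pulled-back closed subscheme over an open maps
# isomorphically onto it there

Topic: `Literature/AlgebraicGeometry/Resolution`. Abstract form of "the strict transform of
`Y ⊆ X` under `p : P → X` maps isomorphically onto `Y` over the open where `p` is an
isomorphism and where the strict transform is the total transform" — the statement that makes a
spread-out resolution birational (`EffectiveResolutionSpread*.lean`). Data: `p : P → X`, a closed
immersion `tι : T → X` (think `T = Y`), an open `D ⊆ X` over which `p⁻¹ D → X` is an open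
immersion (e.g. `p` a blow-up with centre off `D`), and a closed subscheme `V(C) ⊆ P` containing
the total transform `p⁻¹ T` of `T` as far as ideals go (`tι.ker · 𝒪_P ≤ C`, so that
`V(C) → X` factors through `T`, `π : V(C) → T`) and EQUAL to it on `p⁻¹ D`
(`C|_{p⁻¹D} = (tι.ker · 𝒪_P)|_{p⁻¹D}`). Conclusion (`isIso_morphismRestrict_lift`): `π` is an
isomorphism over `tι⁻¹ D`. All PROVED:

* `ker_morphismRestrict_eq_comap` — `(f|_U).ker = f.ker|_U` for `f` quasi-compact;
* `preimage_lift_eq` — `π⁻¹(tι⁻¹ D) = cι⁻¹(p⁻¹ D)`;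
* `isIso_morphismRestrict_lift` — the theorem. Proof: both `V(C) ∩ p⁻¹D ↪ p⁻¹D` and the base
  change `p⁻¹D ×_X T ↪ p⁻¹D` are closed immersions with the same kernel
  (`ker_fst_of_isClosedImmersion`), hence isomorphic (`IsClosedImmersion.isIso_of_ker_eq`), and
  `p⁻¹D ×_X T → T` is an open immersion onto `tι⁻¹ D`.

## Sources

* U. Görtz, T. Wedhorn, *Algebraic Geometry I*, 2nd ed. (2020), (13.19), Prop. 13.91 (3)
  (strict transform; blow-up is an isomorphism off the centre). [cite: GortzWedhorn2020, (13.19)]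
-/

noncomputable section

universe u

open CategoryTheory CategoryTheory.Limits AlgebraicGeometry TopologicalSpace

namespace Literature.AlgebraicGeometry.Resolution

open Scheme.IdealSheafData

/-- **`(f|_U).ker = f.ker|_U`** for `f` quasi-compact (Mathlib `ker_morphismRestrict_ideal`, the
open immersion `U ↪ X` inducing the identity on sections). [folklore] -/
theorem ker_morphismRestrict_eq_comap {X Y : Scheme.{u}} (f : X ⟶ Y) [QuasiCompact f]
    (U : Y.Opens) : (f ∣_ U).ker = f.ker.comap U.ι := by
  apply Scheme.IdealSheafData.ext
  funext V
  rw [Scheme.ker_morphismRestrict_ideal, ideal_comap_of_isOpenImmersion, Scheme.Opens.ι_appIso,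
    Iso.refl_inv]
  symm
  exact Ideal.comap_id _

section

variable {P X T Z : Scheme.{u}} (p : P ⟶ X) (tι : T ⟶ X) [IsClosedImmersion tι]
  (cι : Z ⟶ P) [IsClosedImmersion cι] (D : X.Opens)
  (hle : tι.ker ≤ (cι ≫ p).ker)

omit [IsClosedImmersion cι] in
/-- `π⁻¹(tι⁻¹ D) = cι⁻¹(p⁻¹ D)` for the lift `π : Z → T` of `cι ≫ p`. [folklore] -/
theorem preimage_lift_eq :
    (IsClosedImmersion.lift tι (cι ≫ p) hle) ⁻¹ᵁ (tι ⁻¹ᵁ D) = cι ⁻¹ᵁ (p ⁻¹ᵁ D) := by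
  rw [← Scheme.Hom.comp_preimage, IsClosedImmersion.lift_fac, Scheme.Hom.comp_preimage]

/-- If `p` is an isomorphism over `D` then `p⁻¹ D → X` is an open immersion with image `D`.
[folklore] -/
theorem isOpenImmersion_ι_comp_of_isIso_morphismRestrict (hD : IsIso (p ∣_ D)) :
    IsOpenImmersion ((p ⁻¹ᵁ D).ι ≫ p) := by
  rw [← morphismRestrict_ι]
  infer_instance

/-- … with image `D`. [folklore] -/
theorem range_ι_comp_of_isIso_morphismRestrict (hD : IsIso (p ∣_ D)) :
    Set.range ((p ⁻¹ᵁ D).ι ≫ p) = (D : Set X) := by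
  have hsurj : Function.Surjective (p ∣_ D) := (Scheme.homeoOfIso (asIso (p ∣_ D))).surjective
  rw [← morphismRestrict_ι, Scheme.Hom.comp_base, TopCat.coe_comp, Set.range_comp,
    Set.range_eq_univ.mpr hsurj, Set.image_univ, Scheme.Opens.range_ι]

/-- **The lift `π : V(C) → T` is an isomorphism over `tι⁻¹ D`** when `p` is an isomorphism over
`D` and `C = cι.ker` agrees with `tι.ker · 𝒪_P` on `p⁻¹ D`. [cite: GortzWedhorn2020, (13.19)] -/
theorem isIso_morphismRestrict_lift (hD : IsIso (p ∣_ D))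
    (hC : cι.ker.comap (p ⁻¹ᵁ D).ι = (tι.ker.comap p).comap (p ⁻¹ᵁ D).ι) :
    IsIso ((IsClosedImmersion.lift tι (cι ≫ p) hle) ∣_ (tι ⁻¹ᵁ D)) := by
  set π := IsClosedImmersion.lift tι (cι ≫ p) hle with hπdef
  have hπ : π ≫ tι = cι ≫ p := IsClosedImmersion.lift_fac _ _ _
  set W : P.Opens := p ⁻¹ᵁ D with hWdef
  set U : T.Opens := tι ⁻¹ᵁ D with hUdef
  haveI : IsOpenImmersion (W.ι ≫ p) := isOpenImmersion_ι_comp_of_isIso_morphismRestrict p D hD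
  -- the base change `B = W ×_X T` of `tι` along the open immersion `W → X`
  -- (1) `snd : B → T` is an open immersion onto `U`
  haveI : IsOpenImmersion (pullback.snd (W.ι ≫ p) tι) :=
    MorphismProperty.pullback_snd _ _ inferInstance
  have hrange : Set.range (pullback.snd (W.ι ≫ p) tι) = Set.range U.ι := by
    rw [Scheme.Pullback.range_snd, range_ι_comp_of_isIso_morphismRestrict p D hD,
      Scheme.Opens.range_ι]
    rfl
  let s : pullback (W.ι ≫ p) tι ≅ (U : Scheme.{u}) :=
    IsOpenImmersion.isoOfRangeEq (pullback.snd (W.ι ≫ p) tι) U.ι hrange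
  have hs : s.hom ≫ U.ι = pullback.snd (W.ι ≫ p) tι := IsOpenImmersion.isoOfRangeEq_hom_fac _ _ _
  -- (2) the closed immersions `V(C) ∩ W ↪ W` and `fst : B ↪ W` have the same kernel
  have hker : (cι ∣_ W).ker = (pullback.fst (W.ι ≫ p) tι).ker := by
    rw [ker_morphismRestrict_eq_comap, ker_fst_of_isClosedImmersion, hC,
      ← Scheme.IdealSheafData.comap_comp]
  -- (3) the comparison `l : V(C) ∩ W → B`, an isomorphism
  have hcomm : (cι ∣_ W) ≫ (W.ι ≫ p) = ((cι ⁻¹ᵁ W).ι ≫ π) ≫ tι := by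
    rw [Category.assoc, hπ, ← Category.assoc, morphismRestrict_ι, Category.assoc]
  set l := pullback.lift (cι ∣_ W) ((cι ⁻¹ᵁ W).ι ≫ π) hcomm with hldef
  haveI hl : IsIso l :=
    IsClosedImmersion.isIso_of_ker_eq (cι ∣_ W) (pullback.fst (W.ι ≫ p) tι) l
      (pullback.lift_fst _ _ _) hker
  -- (4) `π⁻¹ U = cι⁻¹ W`
  let j : ((π ⁻¹ᵁ U : Z.Opens) : Scheme.{u}) ≅ (cι ⁻¹ᵁ W : Z.Opens) :=
    Z.isoOfEq (preimage_lift_eq p tι cι D hle)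
  have hj : j.hom ≫ (cι ⁻¹ᵁ W).ι = (π ⁻¹ᵁ U).ι := Scheme.isoOfEq_hom_ι _ _
  -- (5) `π|_U = j ≫ l ≫ s`
  have key : π ∣_ U = j.hom ≫ l ≫ s.hom := by
    haveI : Mono (U.ι ≫ tι) := mono_comp _ _
    rw [← cancel_mono (U.ι ≫ tι)]
    simp only [Category.assoc, morphismRestrict_ι_assoc]
    rw [hπ, reassoc_of% hs, ← pullback.condition, hldef, pullback.lift_fst_assoc,
      morphismRestrict_ι_assoc, reassoc_of% hj]
  rw [key]
  infer_instance

end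

end Literature.AlgebraicGeometry.Resolution

end
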